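import Summits.CriticalPhenomena.PercolationContinuityZ3.Theorems.PercNearOneGluingNoHeavyLowerTailMajorityGluingQCertSymParts
import Summits.CriticalPhenomena.PercolationContinuityZ3.Theorems.PercNearOneGluingNoHeavyLowerTailMajorityGluingQCertSymTenSix
import Summits.CriticalPhenomena.PercolationContinuityZ3.Theorems.PercNearOneGluingNoHeavyLowerTailMajorityGluingEightHarris
import HarnessLib

/-!
# Six of ten relays cut from the hub: `μ ≤ (22/15)·max_i μ(vᵢ ↮ a₀)` by a kernel-checked ORBIT certificate; `C(12), C(13) ≤ 37/15`, `= 2` for `max ≥ 7/22` (lane prim-rate, constants-miner 1, gen 36; CANDIDATES §GEN-36)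

Support file for the closed crux `NoHeavyLowerTail` (stmt-CriticalPhenomena-4575), majority-gluing line.  The ROOT CELL `R_6 = (10,6)` of the window (it closes
`|A| = 12` and, by the cell monotonicity `cutCount_mono`, `|A| = 13`) gets a kernel-checked symmetrised degree-2 Positivstellensatz certificate `QCert.tenSixSym` (kit j285600: symcert.py — the S_m-SYMMETRISED moment LP (pair-orbit pseudo-moments; ALL hub-rooted van den Berg–Kahn row orbits and `2×2` square orbits separated exhaustively; chain-free); exact integer multipliers; re-verified in the Lean semantics by cert/mksym.py; ONE representative per relabelling orbit; the kernel evaluation is split into parts with verified digests (`…MajorityGluing{checkmod}P*`) glued in `…MajorityGluing{checkmod}`):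
**`sixOfTen_tenSixSym` : `μ(6 ≤ #{v ∈ T : v ↮ a₀}) ≤ (22/15)·δ`** for every finite weighted graph, hub `a₀`, `10`-set `T` and `δ ≥` the cut probabilities (an instance of the
generic `QCert.SymCert.cut_of_posS_count`).  Consequences via `cutCount_mono` and the generic Harris layer of `…MajorityGluingEightHarris`:
**`majorityGluing_card_twelve_thirteen_tenSixSym` : `C(12), C(13) ≤ 37/15`** (the tree had 8/3 and 18/7 = 1 + (|A|−2)/⌈|A|/2⌉ from additive gluing / Markov),
**`majorityGluing_two_card_twelve_thirteen_of_ge_tenSixSym` : `C(12) = C(13) = 2` whenever `max ≥ 7/22`**, and the Harris form `δ₀ + (22/15)δ₀(1 − δ₀)`.  No sorries.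
[cite: VandenbergKahn2001, Thm 1.2 (p. 123)] [cite: KozmaNitzan2024, Conj. 1 (p. 3), Conj. 4 (p. 32)]
-/

noncomputable section

namespace Summit.CriticalPhenomena.PercolationContinuityZ3.Theorems

open MeasureTheory Set
open Literature.Probability.LatticeModels (prodBernoulli)
open Literature.Probability.Percolation
open scoped Classical

namespace HubOnly

variable {n : ℕ}

/-- **AT LEAST SIX OF TEN RELAYS CUT: `μ ≤ (22/15)·δ`** for every finite weighted graph, hub `a₀`, `10`-set `T` and `δ` bounding the cut probabilities — the
kernel-checked certificate `QCert.tenSixSym`. [cite: VandenbergKahn2001, Thm 1.2 (p. 123)] -/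
theorem sixOfTen_tenSixSym (w : Sym2 (Fin n) → unitInterval) (a₀ : Fin n) (T : Finset (Fin n)) (hT : T.card = 10) (δ : ℝ)
    (hδ : ∀ v ∈ T, (prodBernoulli w).real (openConn v a₀ : Set (BondConfig (Fin n)))ᶜ ≤ δ) :
    (prodBernoulli w).real {ω : BondConfig (Fin n) | 6 ≤ (T.filter fun v => ω ∉ openConn v a₀).card} ≤ 22 / 15 * δ := by
  obtain ⟨v, hv⟩ : T.Nonempty := by rw [← Finset.card_pos, hT]; norm_num
  have hδ0 : 0 ≤ δ := le_trans measureReal_nonneg (hδ v hv)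
  have h := QCert.SymCert.cut_of_posS_count QCert.tenSixSym QCert.tenSixSym_m QCert.tenSixSym_checkWS QCert.tenSixSym_pos w a₀ T hT δ hδ0 hδ
  rw [QCert.tenSixSym_base] at h
  have hcD : (QCert.tenSixSymBase.cD : ℝ) = 15 := by norm_num [QCert.tenSixSymBase]
  have hcN : (QCert.tenSixSymBase.cN : ℝ) = 22 := by norm_num [QCert.tenSixSymBase]
  have hh : QCert.tenSixSymBase.h = 6 := rfl
  rw [hcD, hcN, hh] at h
  linarith

/-- The cell(s) of `|A| ∈ {12, 13}` obey the constant bound `(22/15)·δ` (via the cell monotonicity `cutCount_mono`). [cite: VandenbergKahn2001, Thm 1.2 (p. 123)] -/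
theorem cell_twelve_thirteen_tenSixSym (p : Sym2 (Fin n) → unitInterval) (A : Finset (Fin n)) (a₀ : Fin n) (hA1 : 12 ≤ A.card) (hA2 : A.card ≤ 13)
    (T : Finset (Fin n)) (δ : ℝ) (haT : a₀ ∉ T) (_hTA : T ⊆ A) (hTcard : T.card + 2 = A.card) (_hδ : 0 ≤ δ)
    (hδT : ∀ v ∈ T, (prodBernoulli p).real (openConn v a₀ : Set (BondConfig (Fin n)))ᶜ ≤ δ) :
    (prodBernoulli p).real {ω : BondConfig (Fin n) | (A.card + 1) / 2 ≤ (T.filter fun v => ω ∉ openConn v a₀).card} ≤ 22 / 15 * δ :=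
  cutCount_mono p a₀ 10 6 δ (22 / 15 * δ) (fun T₀ hT₀ _ hδT₀ => sixOfTen_tenSixSym p a₀ T₀ hT₀ δ hδT₀) T ((A.card + 1) / 2)
    (by omega) (by omega) haT hδT

/-- **MAJORITY GLUING AT `|A| ∈ {12, 13}` WITH LOSS `(37/15)·max`:** `μ(o ↔ A) − (37/15)δ₀ ≤ μ(o ↔ a₀ ∧ 2N > |A|)` for every weight function, observer,
hub `a₀ ∈ A`, `|A| ∈ {12, 13}`, `δ₀ ≥ max_{a∈A} μ(a ↮ a₀)`. [cite: VandenbergKahn2001, Thm 1.2 (p. 123)] [cite: KozmaNitzan2024, Conj. 1 (p. 3)] -/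
theorem majorityGluing_card_twelve_thirteen_tenSixSym (w : Sym2 (Fin n) → unitInterval) (A : Finset (Fin n)) (o a₀ : Fin n) (δ₀ : ℝ)
    (ha₀ : a₀ ∈ A) (hA1 : 12 ≤ A.card) (hA2 : A.card ≤ 13)
    (hδ₀ : ∀ a ∈ A, (prodBernoulli w).real (openConn a a₀ : Set (BondConfig (Fin n)))ᶜ ≤ δ₀) :
    (prodBernoulli w).real (⋃ a ∈ A, openConn o a) - 37 / 15 * δ₀ ≤
      (prodBernoulli w).real {ω : BondConfig (Fin n) | ω ∈ openConn o a₀ ∧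
          A.card < 2 * (A.filter fun a => ω ∈ openConn o a).card} := by
  have h := majorityGluing_of_cellConst w A o a₀ δ₀ ha₀ (by omega) (22 / 15) (by norm_num)
    (fun p _ T δ haT hTA hTcard hδ hδT => cell_twelve_thirteen_tenSixSym p A a₀ hA1 hA2 T δ haT hTA hTcard hδ hδT) hδ₀
  norm_num at h ⊢
  linarith

/-- **MAJORITY GLUING AT `|A| ∈ {12, 13}`, HARRIS FORM:** loss `δ₀ + (22/15)·δ₀·(1 − δ₀)` for `max_{a∈A} μ(a ↮ a₀) ≤ δ₀ ≤ 15/22`.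
[cite: VandenbergKahn2001, Thm 1.2 (p. 123)] [cite: KozmaNitzan2024, Conj. 1 (p. 3)] -/
theorem majorityGluing_harris_card_twelve_thirteen_tenSixSym (w : Sym2 (Fin n) → unitInterval) (A : Finset (Fin n)) (o a₀ : Fin n) (δ₀ : ℝ)
    (ha₀ : a₀ ∈ A) (hA1 : 12 ≤ A.card) (hA2 : A.card ≤ 13)
    (hδ₀ : ∀ a ∈ A, (prodBernoulli w).real (openConn a a₀ : Set (BondConfig (Fin n)))ᶜ ≤ δ₀) (hδ₀' : δ₀ ≤ 15 / 22) :
    (prodBernoulli w).real (⋃ a ∈ A, openConn o a) -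
        (prodBernoulli w).real {ω : BondConfig (Fin n) | ω ∈ openConn o a₀ ∧
          A.card < 2 * (A.filter fun a => ω ∈ openConn o a).card}
      ≤ δ₀ + 22 / 15 * δ₀ * (1 - δ₀) :=
  majorityGluing_harris_of_cellConst w A o a₀ δ₀ ha₀ (by omega) (22 / 15) (by norm_num)
    (fun p _ T δ haT hTA hTcard hδ hδT => cell_twelve_thirteen_tenSixSym p A a₀ hA1 hA2 T δ haT hTA hTcard hδ hδT) hδ₀ (by linarith)

/-- **`C(12) = C(13) = 2` WHENEVER `max ≥ 7/22`:** `μ(o ↔ A) − 2δ₀ ≤ μ(o ↔ a₀ ∧ 2N > |A|)` for `|A| ∈ {12, 13}`, `δ₀ ≥ max_{a∈A} μ(a ↮ a₀)`, `δ₀ ≥ 7/22`.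
[cite: VandenbergKahn2001, Thm 1.2 (p. 123)] [cite: KozmaNitzan2024, Conj. 1 (p. 3), Conj. 4 (p. 32)] -/
theorem majorityGluing_two_card_twelve_thirteen_of_ge_tenSixSym (w : Sym2 (Fin n) → unitInterval) (A : Finset (Fin n)) (o a₀ : Fin n) (δ₀ : ℝ)
    (ha₀ : a₀ ∈ A) (hA1 : 12 ≤ A.card) (hA2 : A.card ≤ 13)
    (hδ₀ : ∀ a ∈ A, (prodBernoulli w).real (openConn a a₀ : Set (BondConfig (Fin n)))ᶜ ≤ δ₀) (hreg : 7 / 22 ≤ δ₀) :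
    (prodBernoulli w).real (⋃ a ∈ A, openConn o a) - 2 * δ₀ ≤
      (prodBernoulli w).real {ω : BondConfig (Fin n) | ω ∈ openConn o a₀ ∧
          A.card < 2 * (A.filter fun a => ω ∈ openConn o a).card} :=
  majorityGluing_two_of_cellConst w A o a₀ δ₀ ha₀ (by omega) (22 / 15) (by norm_num)
    (fun p _ T δ haT hTA hTcard hδ hδT => cell_twelve_thirteen_tenSixSym p A a₀ hA1 hA2 T δ haT hTA hTcard hδ hδT) hδ₀ (by linarith)

end HubOnly

end Summit.CriticalPhenomena.PercolationContinuityZ3.Theorems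

end
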